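import Literature.Analysis.SpecialFunctions.JacobiThetaAGM
import Mathlib.NumberTheory.ModularForms.Discriminant
import HarnessLib

/-!
# The thetanulls as eta quotients: `(ϑ₂ϑ₃ϑ₄)⁸ = 2⁸ η²⁴`, `ϑ₄(τ) η(τ) = η(τ/2)²`,
# and `ϑ₃(iy) = |η((±1 + iy)/2)|² / |η(iy)|`

Topic `Literature/Analysis/SpecialFunctions` (sequel of `JacobiThetaAGM.lean`; thetanulls
`Literature.NumberTheory.EllipticCurves.JacobiThetaNull.theta2/3/4`, built from Mathlib's
`jacobiTheta₂`, and Mathlib's Dedekind eta function `ModularForm.eta`, `η(τ) = q^{1/24} ∏(1 − qⁿ)`,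
`q = e^{2πiτ}`). Everything here is PROVED; no definition and no named fact is introduced.

Classically (Whittaker–Watson §21.42–21.43, from Jacobi's triple product)
`ϑ₃(τ) = η((τ+1)/2)²/η(τ+1)`, `ϑ₄(τ) = η(τ/2)²/η(τ)`, `ϑ₂(τ) = 2η(2τ)²/η(τ)` and
`ϑ₂ϑ₃ϑ₄ = 2η³`. We obtain them WITHOUT the triple product, from Mathlib's level-one theory:

* `thetaP_pow_eight_eq_discriminant` — **`(ϑ₂ϑ₃ϑ₄)(τ)⁸ = 256 Δ(τ) = 256 η(τ)²⁴`** on `ℍ`: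
  the tree's cusp form `cuspF₂ = (ϑ₂ϑ₃ϑ₄)⁸ ∈ S₁₂(SL₂(ℤ))` (`JacobiThetaDerivativeFormula.lean`) is a
  multiple of `Δ` (`dim S₁₂ = 1`, Mathlib), and the constant is `2⁸` because
  `e^{−πiτ/4} ϑ₂ϑ₃ϑ₄ → 2` and `Δ/q → 1` at `i∞`;
* `norm_thetaP_eq` — `|ϑ₂ϑ₃ϑ₄(τ)| = 2|η(τ)|³`; `eta_I_mul_eq_norm` — `η(iy) > 0` for `y > 0`;
* `theta4_two_I_mul_re_eq`, `theta4_mul_eta_two_I_mul` — on the imaginary axis `ϑ₄(2iy) = η(iy)²/η(2iy)`, from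
  `P(iy)² = 2P(2iy)ϑ₄(2iy)³` (Landen: `ϑ₃ϑ₄ = ϑ₄(2τ)²`, `ϑ₂(τ)² = 2ϑ₂(2τ)ϑ₃(2τ)`) and
  `P = 2η³` for the positive axis values;
* `theta4_mul_eta` — **`ϑ₄(τ) η(τ) = η(τ/2)²` on all of `ℍ`** (identity theorem from the axis);
* `theta3_mul_eta_sub_one`, **`theta3_I_mul_re_eq_norm_eta`** (and `…_eta'`) — `ϑ₃(τ) η(τ−1) = η((τ−1)/2)²`, and for
  `y > 0`: `ϑ₃(iy) = |η((−1+iy)/2)|²/|η(iy)| = |η((1+iy)/2)|²/|η(iy)|`.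

The last formula is the junction between the theta side of singular values
(`K(k_N) = (π/2)ϑ₃(i√N)²`, `JacobiThetaAGM.lean`) and Kronecker's limit formula, which produces
`|η|` at the CM points `(b + i√|D|)/(2a)` of the reduced forms
(`Literature/NumberTheory/QuadraticFields/EpsteinZetaKroneckerLimitExact.lean`); it is the
"eta–theta identity" input named in `Literature/Analysis/FunctionSpaces/UniformRandomWalkDensityTheta.lean`
for the Chowla–Selberg value behind `Literature.Analysis.FunctionSpaces.BorweinStraubWanZudilin2012_eq_5_3`.

## References

* E. T. Whittaker, G. N. Watson, *A Course of Modern Analysis*, 4th ed. (1927), §21.41–§21.43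
  (`ϑ₁' = ϑ₂ϑ₃ϑ₄`, the thetanulls as `q`-products). [WhittakerWatson1927]
* D. F. Lawden, *Elliptic Functions and Applications* (1989), §1.8 (Landen's transformation).
  [Lawden1989]
* F. Diamond, J. Shurman, *A First Course in Modular Forms* (2005), §1.2 (`Δ = η²⁴`, Mathlib).
-/

noncomputable section

open Complex Real Filter Topology
open UpperHalfPlane hiding I
open scoped Real ModularForm

namespace Literature.Analysis.SpecialFunctions

open Literature.NumberTheory.EllipticCurves.JacobiThetaNull
open ModularForm (eta_q eta_ne_zero)

/-! ### `(ϑ₂ϑ₃ϑ₄)⁸ = 256 Δ` -/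

/-- `e^{−2πiτ} (ϑ₂ϑ₃ϑ₄)(τ)⁸ → 256` at `i∞` (the eighth power of `e^{−πiτ/4}P(τ) → 2`). [folklore] -/
theorem tendsto_exp_mul_thetaP_pow_eight :
    Tendsto (fun τ : ℂ => cexp (-(2 * π * I * τ)) * thetaP τ ^ 8) (comap im atTop) (𝓝 256) := by
  have h := tendsto_thetaP.pow 8
  rw [show (2 : ℂ) ^ 8 = 256 by norm_num] at h
  refine h.congr fun τ => ?_
  rw [mul_pow, ← Complex.exp_nat_mul]
  congr 2
  push_cast
  ring

/-- `e^{−2πiτ} Δ(τ) = ∏ (1 − qⁿ)²⁴ → 1` at `i∞` (Mathlib). [folklore] -/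
theorem tendsto_exp_mul_discriminant :
    Tendsto (fun τ : ℍ => cexp (-(2 * π * I * (τ : ℂ))) * ModularForm.discriminant τ)
      atImInfty (𝓝 1) := by
  refine ModularForm.tendsto_atImInfty_tprod_one_sub_eta_q_pow.congr fun τ => ?_
  rw [ModularForm.discriminant_eq_q_prod, ← mul_assoc]
  have : cexp (-(2 * π * I * (τ : ℂ))) * Function.Periodic.qParam 1 (τ : ℂ) = 1 := by
    rw [Function.Periodic.qParam, ← Complex.exp_add, ← Complex.exp_zero]
    congr 1
    push_cast
    ring
  rw [this, one_mul]

/-- **`(ϑ₂ϑ₃ϑ₄)(τ)⁸ = 256 Δ(τ)` on `ℍ`**: `P⁸ ∈ S₁₂(SL₂(ℤ)) = ℂΔ` (tree `cuspF₂`, Mathlib's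
dimension formula) and the constant is fixed by the limits `e^{−2πiτ}P⁸ → 2⁸`, `e^{−2πiτ}Δ → 1`.
[cite: WhittakerWatson1927, §21.41–21.43] -/
theorem thetaP_pow_eight_eq_discriminant (τ : ℍ) :
    thetaP τ ^ 8 = 256 * ModularForm.discriminant τ := by
  obtain ⟨c, hc⟩ := exists_eq_mul_discriminant cuspF₂
  have hc' : ∀ z : ℍ, thetaP z ^ 8 = c * ModularForm.discriminant z := fun z => by
    have := hc z
    rwa [cuspF₂, cuspFormOf_apply] at this
  -- the constant: compare the two limits at `i∞`
  have h1 : Tendsto (fun z : ℍ => cexp (-(2 * π * I * (z : ℂ))) * thetaP z ^ 8) atImInfty (𝓝 256) :=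
    tendsto_exp_mul_thetaP_pow_eight.comp tendsto_coe_atImInfty
  have h2 : Tendsto (fun z : ℍ => cexp (-(2 * π * I * (z : ℂ))) * thetaP z ^ 8) atImInfty (𝓝 (c * 1)) := by
    refine (tendsto_exp_mul_discriminant.const_mul c).congr fun z => ?_
    rw [hc' z]
    ring
  have hc256 : c = 256 := by
    have := tendsto_nhds_unique h2 h1
    rwa [mul_one] at this
  rw [hc' τ, hc256]

/-- **`(ϑ₂ϑ₃ϑ₄)(τ)⁸ = 256 η(τ)²⁴`** for `Im τ > 0`. [cite: WhittakerWatson1927, §21.41–21.43] -/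
theorem thetaP_pow_eight_eq_eta {τ : ℂ} (hτ : 0 < im τ) :
    thetaP τ ^ 8 = 256 * η τ ^ 24 := by
  have := thetaP_pow_eight_eq_discriminant ⟨τ, hτ⟩
  simpa [ModularForm.discriminant] using this

/-- **`|ϑ₂ϑ₃ϑ₄(τ)| = 2 |η(τ)|³`** on `ℍ`. [cite: WhittakerWatson1927, §21.41–21.43] -/
theorem norm_thetaP_eq {τ : ℂ} (hτ : 0 < im τ) : ‖thetaP τ‖ = 2 * ‖η τ‖ ^ 3 := by
  have h := congrArg norm (thetaP_pow_eight_eq_eta hτ)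
  rw [norm_pow, norm_mul, norm_pow] at h
  have h' : ‖thetaP τ‖ ^ 8 = (2 * ‖η τ‖ ^ 3) ^ 8 := by
    rw [h]; norm_num; ring
  exact (pow_left_inj₀ (norm_nonneg _) (by positivity) (by norm_num : (8 : ℕ) ≠ 0)).mp h'

/-! ### The eta function on the positive imaginary axis -/

variable {y : ℝ}

/-- `iy ∈ ℍ` for `y > 0`. [folklore] -/
private theorem I_mul_mem (hy : 0 < y) : (I * y : ℂ) ∈ upperHalfPlaneSet := by
  show 0 < im (I * y); simpa using hy

/-- **`η(iy)` is a positive real number** (`y > 0`): `η(iy) = e^{−πy/12} ∏ (1 − e^{−2π(n+1)y})`,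
written as `η(iy) = |η(iy)|`. [folklore] -/
theorem eta_I_mul_eq_norm (hy : 0 < y) : η (I * y) = (‖η (I * y)‖ : ℂ) := by
  -- `η(iy) = exp(real)`: the `q`-factor and every factor of the product are positive reals
  set q : ℝ := rexp (-(2 * π * y)) with hq
  have hq0 : 0 < q := Real.exp_pos _
  have hq1 : q < 1 := by
    rw [hq, Real.exp_lt_one_iff]
    have := Real.pi_pos
    nlinarith
  have hterm : ∀ n : ℕ, eta_q n (I * y) = ((q ^ (n + 1) : ℝ) : ℂ) := by
    intro n
    rw [ModularForm.eta_q_eq_pow, hq]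
    push_cast
    rw [← Complex.exp_nat_mul, ← Complex.exp_nat_mul]
    congr 1
    push_cast
    linear_combination (2 * ↑π * (↑n + 1) * (y : ℂ)) * I_mul_I
  have hfac_pos : ∀ n : ℕ, 0 < 1 - q ^ (n + 1) := fun n =>
    sub_pos.mpr (pow_lt_one₀ hq0.le hq1 (Nat.succ_ne_zero n))
  have hfn : ∀ n : ℕ, (1 : ℂ) - eta_q n (I * y) ≠ 0 := fun n =>
    ModularForm.one_sub_eta_q_ne_zero n (I_mul_mem hy)
  -- summability of the logarithms (real), hence of the complex logarithms
  have hlogR : Summable fun n : ℕ => Real.log (1 - q ^ (n + 1)) := by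
    have hs : Summable fun n : ℕ => -q ^ (n + 1) :=
      ((summable_geometric_of_lt_one hq0.le hq1).mul_left q).neg.congr fun n => by ring
    refine (Real.summable_log_one_add_of_summable hs).congr fun n => ?_
    ring_nf
  have hlogC : ∀ n : ℕ, Complex.log (1 - eta_q n (I * y)) = ((Real.log (1 - q ^ (n + 1)) : ℝ) : ℂ) := by
    intro n
    rw [hterm n, Complex.ofReal_log (hfac_pos n).le]
    push_cast
    ring_nf
  have hlog : Summable fun n : ℕ => Complex.log (1 - eta_q n (I * y)) := by
    simp_rw [hlogC]
    exact (Complex.summable_ofReal.mpr hlogR)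
  have hprod : ∏' n : ℕ, (1 - eta_q n (I * y)) =
      ((rexp (∑' n : ℕ, Real.log (1 - q ^ (n + 1))) : ℝ) : ℂ) := by
    rw [← Complex.cexp_tsum_eq_tprod hfn hlog, Complex.ofReal_exp, Complex.ofReal_tsum]
    congr 1
    exact tsum_congr hlogC
  have hqfac : Function.Periodic.qParam 24 (I * y) = ((rexp (-(π * y / 12)) : ℝ) : ℂ) := by
    rw [Function.Periodic.qParam, Complex.ofReal_exp]
    congr 1
    push_cast
    linear_combination (↑π * (y : ℂ) / 12) * I_mul_I
  have heta : η (I * y) =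
      ((rexp (-(π * y / 12)) * rexp (∑' n : ℕ, Real.log (1 - q ^ (n + 1))) : ℝ) : ℂ) := by
    unfold ModularForm.eta
    rw [hqfac, hprod]
    push_cast
    ring
  rw [heta, Complex.norm_real, Real.norm_of_nonneg (by positivity)]

/-- `|η(iy)| > 0`. [folklore] -/
theorem norm_eta_I_mul_pos (hy : 0 < y) : 0 < ‖η (I * y)‖ :=
  norm_pos_iff.mpr (eta_ne_zero (I_mul_mem hy))

/-- On the axis `P(iy) = ϑ₂ϑ₃ϑ₄(iy) = 2 η(iy)³` (the positive values). [cite: WhittakerWatson1927, §21.41] -/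
theorem thetaP_I_mul_re_eq (hy : 0 < y) : (thetaP (I * y)).re = 2 * ‖η (I * y)‖ ^ 3 := by
  have h := norm_thetaP_eq (im_I_mul_pos hy)
  rw [thetaP_I_mul_eq_re hy, Complex.norm_real, Real.norm_of_nonneg (thetaP_I_mul_re_pos hy).le] at h
  exact h

/-- **`ϑ₂(iy)² = 2 ϑ₂(2iy) ϑ₃(2iy)`** (Landen; from `ϑ₂⁴ = ϑ₃⁴ − ϑ₄⁴ = (2ϑ₂(2τ)²)(2ϑ₃(2τ)²)` and
positivity on the axis). [cite: Lawden1989, §1.8 eqs. (1.8.5)–(1.8.6)] -/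
theorem theta2_re_sq_eq_two_mul (hy : 0 < y) :
    (theta2 (I * y)).re ^ 2 = 2 * (theta2 (I * ↑(2 * y))).re * (theta3 (I * ↑(2 * y))).re := by
  have h2y : 0 < 2 * y := by positivity
  have hq := theta3_I_mul_re_pow_four hy
  have h2 := theta2_re_sq_two_mul hy
  have h3 := theta3_re_sq_two_mul hy
  -- `ϑ₂(iy)⁴ = (2ϑ₂(2iy)ϑ₃(2iy))²`
  have h4 : ((theta2 (I * y)).re ^ 2) ^ 2 =
      (2 * (theta2 (I * ↑(2 * y))).re * (theta3 (I * ↑(2 * y))).re) ^ 2 := by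
    nlinarith [hq, h2, h3]
  have hpos1 : 0 ≤ (theta2 (I * y)).re ^ 2 := sq_nonneg _
  have hpos2 : 0 ≤ 2 * (theta2 (I * ↑(2 * y))).re * (theta3 (I * ↑(2 * y))).re := by
    have := theta2_I_mul_re_pos h2y
    have := theta3_I_mul_re_pos h2y
    positivity
  exact (pow_left_inj₀ hpos1 hpos2 two_ne_zero).mp h4

/-- **`ϑ₄(2iy) = η(iy)²/η(2iy)`** (`y > 0`), as positive reals: from `P(iy)² = 2P(2iy)ϑ₄(2iy)³`
(Landen) and `P = 2η³`. [cite: WhittakerWatson1927, §21.42] -/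
theorem theta4_two_I_mul_re_eq (hy : 0 < y) :
    (theta4 (I * ↑(2 * y))).re = ‖η (I * y)‖ ^ 2 / ‖η (I * ↑(2 * y))‖ := by
  have h2y : 0 < 2 * y := by positivity
  have hP1 := thetaP_I_mul_re_eq hy
  have hP2 := thetaP_I_mul_re_eq h2y
  have hL := theta2_re_sq_eq_two_mul hy
  have hM := theta4_re_sq_two_mul hy
  have he1 := norm_eta_I_mul_pos hy
  have he2 := norm_eta_I_mul_pos h2y
  have ht4 := theta4_I_mul_re_pos h2y
  -- real parts of products on the axis
  have hre : ∀ {t : ℝ} (ht : 0 < t), (thetaP (I * t)).re =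
      (theta2 (I * t)).re * (theta3 (I * t)).re * (theta4 (I * t)).re := by
    intro t ht
    have h := thetaP_I_mul_eq_re ht
    rw [thetaP, theta2_I_mul_eq_re ht, theta3_I_mul_eq_re ht, theta4_I_mul_eq_re ht] at h
    have h' := congrArg Complex.re h
    simp only [← Complex.ofReal_mul, Complex.ofReal_re] at h'
    rw [thetaP, theta2_I_mul_eq_re ht, theta3_I_mul_eq_re ht, theta4_I_mul_eq_re ht]
    simp only [← Complex.ofReal_mul, Complex.ofReal_re]
  have hP1' := hre hy
  have hP2' := hre h2y
  -- `P(iy)² = 2 P(2iy) ϑ₄(2iy)³`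
  have key : (thetaP (I * y)).re ^ 2 = 2 * (thetaP (I * ↑(2 * y))).re * (theta4 (I * ↑(2 * y))).re ^ 3 := by
    rw [hP1', hP2']
    have : ((theta2 (I * y)).re * (theta3 (I * y)).re * (theta4 (I * y)).re) ^ 2 =
        (theta2 (I * y)).re ^ 2 * ((theta3 (I * y)).re * (theta4 (I * y)).re) ^ 2 := by ring
    rw [this, hL, ← hM]
    ring
  rw [hP1, hP2] at key
  -- `ϑ₄(2iy)³ = (η(iy)²/η(2iy))³`
  have key' : (theta4 (I * ↑(2 * y))).re ^ 3 = (‖η (I * y)‖ ^ 2 / ‖η (I * ↑(2 * y))‖) ^ 3 := by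
    field_simp
    nlinarith [key, pow_pos he2 3, pow_pos he1 3]
  exact (pow_left_inj₀ ht4.le (by positivity) three_ne_zero).mp key'

/-- `ϑ₄(2iy) η(2iy) = η(iy)²` as complex numbers (`y > 0`). [cite: WhittakerWatson1927, §21.42] -/
theorem theta4_mul_eta_two_I_mul (hy : 0 < y) :
    theta4 (I * ↑(2 * y)) * η (I * ↑(2 * y)) = η (I * y) ^ 2 := by
  have h2y : 0 < 2 * y := by positivity
  have he1 := norm_eta_I_mul_pos hy
  have he2 := norm_eta_I_mul_pos h2y
  have A : theta4 (I * ↑(2 * y)) = ((‖η (I * y)‖ ^ 2 / ‖η (I * ↑(2 * y))‖ : ℝ) : ℂ) := by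
    rw [theta4_I_mul_eq_re h2y, theta4_two_I_mul_re_eq hy]
  set a : ℝ := ‖η (I * y)‖ with ha
  set b : ℝ := ‖η (I * ↑(2 * y))‖ with hb
  have B : η (I * ↑(2 * y)) = (b : ℂ) := eta_I_mul_eq_norm h2y
  have C : η (I * y) = (a : ℂ) := eta_I_mul_eq_norm hy
  rw [A, B, C]
  have hb0 : (b : ℂ) ≠ 0 := Complex.ofReal_ne_zero.mpr he2.ne'
  push_cast
  field_simp

/-! ### `ϑ₄(τ) η(τ) = η(τ/2)²` on the upper half-plane -/

/-- **`ϑ₄(τ) η(τ) = η(τ/2)²` for `Im τ > 0`** (Whittaker–Watson §21.42 `ϑ₄ = ∏(1−q²ⁿ)(1−q²ⁿ⁻¹)²`,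
in eta form): both sides are holomorphic on `ℍ` and they agree on the positive imaginary axis
(`theta4_mul_eta_two_I_mul`), which accumulates at `2i`; identity theorem.
[cite: WhittakerWatson1927, §21.42] -/
theorem theta4_mul_eta {τ : ℂ} (hτ : 0 < im τ) : theta4 τ * η τ = η (τ / 2) ^ 2 := by
  set U : Set ℂ := {z | 0 < z.im} with hU
  have hUo : IsOpen U := isOpen_lt continuous_const Complex.continuous_im
  have hUc : IsPreconnected U := (convex_halfSpace_im_gt 0).isPreconnected
  set F : ℂ → ℂ := fun z => theta4 z * η z with hF
  set G : ℂ → ℂ := fun z => η (z / 2) ^ 2 with hG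
  have hFa : AnalyticOnNhd ℂ F U := by
    apply DifferentiableOn.analyticOnNhd _ hUo
    intro z hz
    exact ((differentiableAt_theta4 hz).mul
      (ModularForm.differentiableAt_eta_of_mem_upperHalfPlaneSet hz)).differentiableWithinAt
  have hGa : AnalyticOnNhd ℂ G U := by
    apply DifferentiableOn.analyticOnNhd _ hUo
    intro z hz
    have hz2 : z / 2 ∈ upperHalfPlaneSet := by
      show 0 < (z / 2).im
      have : (z / 2).im = z.im / 2 := by simp
      rw [this]; exact half_pos hz
    have hdiv : DifferentiableAt ℂ (fun w : ℂ => w / 2) z := differentiableAt_id.div_const (2 : ℂ)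
    have hcomp : DifferentiableAt ℂ (fun w : ℂ => η (w / 2)) z :=
      DifferentiableAt.comp (g := ModularForm.eta) (f := fun w : ℂ => w / 2) z
        (ModularForm.differentiableAt_eta_of_mem_upperHalfPlaneSet hz2) hdiv
    exact (hcomp.pow 2).differentiableWithinAt
  have hz₀ : (I * ((2 : ℝ) : ℂ)) ∈ U := by show 0 < im (I * ((2 : ℝ) : ℂ)); simp
  -- agreement on the axis, frequently near `2i`
  have hfreq : ∃ᶠ z in 𝓝[≠] (I * ((2 : ℝ) : ℂ)), F z = G z := by
    have h_real : ∃ᶠ t : ℝ in 𝓝[≠] (2 : ℝ), F (I * t) = G (I * t) := by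
      have hev : ∀ᶠ t : ℝ in 𝓝[≠] (2 : ℝ), F (I * t) = G (I * t) := by
        have : ∀ᶠ t : ℝ in 𝓝 (2 : ℝ), 0 < t := Ioi_mem_nhds (by norm_num)
        filter_upwards [nhdsWithin_le_nhds this] with t ht
        have h := theta4_mul_eta_two_I_mul (half_pos ht)
        simp only [hF, hG]
        rw [show (2 * (t / 2) : ℝ) = t by ring] at h
        rw [h]
        congr 1
        push_cast
        ring
      exact hev.frequently
    rw [frequently_iff_seq_forall] at h_real ⊢
    obtain ⟨ts, ht_tendsto, ht_eq⟩ := h_real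
    refine ⟨fun n => I * (ts n : ℂ), ?_, fun n => ht_eq n⟩
    rw [tendsto_nhdsWithin_iff] at ht_tendsto ⊢
    constructor
    · exact ((continuous_const.mul Complex.continuous_ofReal).tendsto _).comp ht_tendsto.1
    · filter_upwards [ht_tendsto.2] with n hn
      simp only [Set.mem_compl_iff, Set.mem_singleton_iff] at hn ⊢
      intro h
      apply hn
      have := congrArg Complex.im h
      simpa using this
  have hEq : Set.EqOn F G U := hFa.eqOn_of_preconnected_of_frequently_eq hGa hUc hz₀ hfreq
  exact hEq hτ

/-- `η(τ + 1) = e^{2πi/24} η(τ)` (the `q^{1/24}` factor; every `qⁿ` is `1`-periodic). [folklore] -/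
theorem eta_add_one (τ : ℂ) : η (τ + 1) = cexp (2 * π * I / 24) * η τ := by
  unfold ModularForm.eta
  have h1 : Function.Periodic.qParam 24 (τ + 1) = cexp (2 * π * I / 24) * Function.Periodic.qParam 24 τ := by
    rw [Function.Periodic.qParam, Function.Periodic.qParam, ← Complex.exp_add]
    congr 1
    push_cast
    ring
  have h2 : ∀ n : ℕ, eta_q n (τ + 1) = eta_q n τ := by
    intro n
    rw [ModularForm.eta_q_eq_cexp, ModularForm.eta_q_eq_cexp]
    rw [show 2 * ↑π * I * (↑n + 1) * (τ + 1) = 2 * ↑π * I * (↑n + 1) * τ + ((n + 1 : ℕ) : ℂ) * (2 * π * I) by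
      push_cast; ring, Complex.exp_add, Complex.exp_nat_mul_two_pi_mul_I, mul_one]
  rw [h1]
  simp_rw [h2]
  ring

/-- `|η(τ + 1)| = |η(τ)|`. [folklore] -/
theorem norm_eta_add_one (τ : ℂ) : ‖η (τ + 1)‖ = ‖η τ‖ := by
  rw [eta_add_one, norm_mul, Complex.norm_exp]
  have : (2 * ↑π * I / 24 : ℂ).re = 0 := by simp
  rw [this, Real.exp_zero, one_mul]

/-- **`ϑ₃(τ) η(τ − 1) = η((τ − 1)/2)²` on `ℍ`** (`ϑ₃(τ) = ϑ₄(τ − 1)`; Whittaker–Watson §21.42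
`ϑ₃ = ∏(1−q²ⁿ)(1+q²ⁿ⁻¹)²` in eta form). [cite: WhittakerWatson1927, §21.42] -/
theorem theta3_mul_eta_sub_one {τ : ℂ} (hτ : 0 < im τ) :
    theta3 τ * η (τ - 1) = η ((τ - 1) / 2) ^ 2 := by
  have h := theta4_mul_eta (τ := τ - 1) (by simpa using hτ)
  rwa [show theta4 (τ - 1) = theta3 τ by rw [← theta3_add_one, sub_add_cancel]] at h

/-- **`ϑ₃(iy) = |η((−1 + iy)/2)|² / |η(iy)|` for `y > 0`** — the thetanull of the singular-value
formula `K(k_N) = (π/2)ϑ₃(i√N)²` as an eta quotient at the CM points `(−1+i√N)/2`, `i√N`.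
[cite: WhittakerWatson1927, §21.42] -/
theorem theta3_I_mul_re_eq_norm_eta (hy : 0 < y) :
    (theta3 (I * y)).re = ‖η ((-1 + I * y) / 2)‖ ^ 2 / ‖η (I * y)‖ := by
  have h := congrArg norm (theta3_mul_eta_sub_one (im_I_mul_pos hy))
  rw [norm_mul, norm_pow, show (I * ↑y - 1 : ℂ) = -1 + I * y by ring,
    show (-1 + I * ↑y : ℂ) = I * y + (-1 : ℝ) by push_cast; ring] at h
  have hper : ‖η (I * ↑y + ((-1 : ℝ) : ℂ))‖ = ‖η (I * y)‖ := by
    have := norm_eta_add_one (I * y + ((-1 : ℝ) : ℂ))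
    rw [show I * ↑y + ((-1 : ℝ) : ℂ) + 1 = I * y by push_cast; ring] at this
    exact this.symm
  rw [hper, theta3_I_mul_eq_re hy, Complex.norm_real, Real.norm_of_nonneg (theta3_I_mul_re_pos hy).le] at h
  have he := norm_eta_I_mul_pos hy
  rw [eq_div_iff he.ne', h]
  congr 2
  push_cast
  ring

/-- The same with the conjugate CM point: **`ϑ₃(iy) = |η((1 + iy)/2)|² / |η(iy)|`**
(`|η(τ + 1)| = |η(τ)|`). [cite: WhittakerWatson1927, §21.42] -/
theorem theta3_I_mul_re_eq_norm_eta' (hy : 0 < y) :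
    (theta3 (I * y)).re = ‖η ((1 + I * y) / 2)‖ ^ 2 / ‖η (I * y)‖ := by
  rw [theta3_I_mul_re_eq_norm_eta hy]
  have := norm_eta_add_one ((-1 + I * y) / 2)
  rw [show (-1 + I * ↑y) / 2 + 1 = (1 + I * y) / 2 by ring] at this
  rw [this]

end Literature.Analysis.SpecialFunctions
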